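import Summits.HubbardSuperconductivity.HubbardSuperconductivity.Theses.JosephsonMirror
import Literature.MathematicalPhysics.QuantumLattice.FockRelabel
import HarnessLib

/-!
# Negative lemma for `JosephsonMirror.JmPairBridge` (stmt-HubbardSuperconductivity-2226) modulo `FloorSymmetryMismatch`

Crux `JmPairBridge` (thesis X of route `JosephsonMirror`): at some `U > 0`, `δ ∈ (0, 1/2)`, eventually in even `L`,
EVERY unit ground state `φ` of `hubbardTorus 2 L 1 U` in the sector `(N_L, S^z = 0)` has a unit ground state `χ` of
`(N_L − 2, S^z = 0)` with `a L⁴ ≤ |⟨χ, Δ_d φ⟩|²` (`Δ_d = pairField dWaveFormFactor L`).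

This file is the route's kill criterion (a)/(b) ("selection-rule mismatch between `G(N_L)` and `G(N_L − 2)`": momentum /
`C₄` character of open-shell floors) as a Lean implication — the SYMMETRY SELECTION RULE for the `d_{x²-y²}` pair field:

* `dotProduct_mulVec_eq_zero_of_twisted_eigen` (abstract): if `V` preserves inner products, `V Δ = c • Δ V`,
  `V φ = λ φ`, `V χ = μ χ` and `μ̄ c λ ≠ 1`, then `⟨χ, Δ φ⟩ = 0`;
* `spaceGroup_mul_pairField_dWave`: for the space-group element `g = (γ, v)` of the square torus, realised on Fock space by
  the tree's unitaries `U_g = fockD4 γ · fockTranslate v` (`Literature/…/FockRelabel`), `U_g Δ_d = χ_{B₁g}(γ) • Δ_d U_g`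
  (`Δ_d` is translation invariant and transforms in `B₁g` under `D₄`: `relabel_translate_pairField`,
  `relabel_d4Perm_pairField_dWave`);
* `FloorSymmetryMismatch` (HYPOTHESIS H, not constructible in the tree today): for every `U > 0`, `δ ∈ (0,1/2)` and `L₀`
  there is an even `L ≥ L₀` with a space-group element `g`, a unit ground state `φ` of `(N_L, 0)` with `U_g φ = λ φ`, and
  the whole `(N_L − 2, 0)` ground floor `g`-isotypic, `U_g χ = μ χ`, with the WRONG character `μ ≠ χ_{B₁g}(γ) λ`;
* `JmPairBridge_false_of_FloorSymmetryMismatch : FloorSymmetryMismatch → ¬ JmPairBridge`: at the `L` supplied by H beyond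
  the crux's threshold, the crux's `χ` for that `φ` has `⟨χ, Δ_d φ⟩ = 0` by the selection rule, contradicting `a L⁴ > 0`.

Why H is not constructible here: it asks for the exact space-group quantum numbers of the `(N_L, 0)` and `(N_L − 2, 0)`
ground floors of the doped (`δ > 0`) repulsive (`U > 0`) two-dimensional Hubbard torus for infinitely many `L` at EVERY
`(U, δ)`; no sign structure (Perron–Frobenius) or reflection positivity is available there (Lieb's spin-reflection
positivity needs half filling or `U < 0`), and exact diagonalisation reaches only `L ≤ 4`. In the clean `d`-wave scenario
H is expected to FAIL at the `d`-wave point (`P_N|BCS_d⟩` has character `χ_{B₁g}^{N/2}`, alternating with `N/2`, and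
`Δ_d ∈ B₁g` bridges `N → N − 2`; cf. the route's why-might-fail), so this lemma does not bear on the truth of the crux; it
records precisely what a refutation by quantum numbers must establish.

Sources: D. J. Scalapino, Phys. Rep. 250 (1995) 329, §2 (`d_{x²-y²} ∈ B₁g` of `C₄ᵥ`); E. P. Wigner, *Group Theory*
(1959) ch. 12 (selection rules for tensor operators of one-dimensional representations); the tree's `FockRelabel`.
No named fact; pure finite-dimensional linear algebra over the tree's definitions.
-/

noncomputable section

set_option linter.dupNamespace false -- `Summit.<S>.<S>`-style doubling is the tree convention for this summit

namespace Summit.HubbardSuperconductivity.JmPairBridgeNegative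

open Matrix Literature.MathematicalPhysics.QuantumLattice
open Summit.HubbardSuperconductivity.HubbardSuperconductivity.Theses.JosephsonMirror (JmPairBridge)

/-! ## The abstract selection rule -/

/-- **Selection rule (abstract).** If `V` preserves the Hermitian inner product, twists `Δ` by the scalar `c`
(`V Δ = c • Δ V`), and `φ`, `χ` are `V`-eigenvectors with eigenvalues `lam`, `mu` such that `star mu * c * lam ≠ 1`,
then the matrix element `⟨χ, Δ φ⟩` vanishes. [folklore] -/
theorem dotProduct_mulVec_eq_zero_of_twisted_eigen {n : Type*} [Fintype n]
    (V Δ : Matrix n n ℂ) (c lam mu : ℂ) (φ χ : n → ℂ)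
    (hV : ∀ x y : n → ℂ, star (V *ᵥ x) ⬝ᵥ (V *ᵥ y) = star x ⬝ᵥ y)
    (hΔ : V * Δ = c • (Δ * V)) (hφ : V *ᵥ φ = lam • φ) (hχ : V *ᵥ χ = mu • χ)
    (hne : star mu * c * lam ≠ 1) :
    star χ ⬝ᵥ (Δ *ᵥ φ) = 0 := by
  have h1 : V *ᵥ (Δ *ᵥ φ) = (c * lam) • (Δ *ᵥ φ) := by
    rw [mulVec_mulVec, hΔ, smul_mulVec, ← mulVec_mulVec, hφ, mulVec_smul, smul_smul]
  have h2 := hV χ (Δ *ᵥ φ)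
  rw [h1, hχ, star_smul, smul_dotProduct, dotProduct_smul, smul_eq_mul, smul_eq_mul, ← mul_assoc] at h2
  -- `(star mu * c * lam) * z = z` with `star mu * c * lam ≠ 1` forces `z = 0`
  have h3 : (star mu * c * lam - 1) * (star χ ⬝ᵥ (Δ *ᵥ φ)) = 0 := by
    rw [sub_mul, one_mul, sub_eq_zero]
    simpa [mul_assoc] using h2
  rcases mul_eq_zero.mp h3 with h | h
  · exact absurd (sub_eq_zero.mp h) hne
  · exact h

/-- The Fock-space unitary `U_π` of an orbital permutation preserves the Hermitian inner product
`⟨x, y⟩ = star x ⬝ᵥ y` (sesquilinear form of the tree's `star_fockRelabel_mulVec_dotProduct`). [folklore] -/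
theorem star_fockRelabel_mulVec_dotProduct_mulVec {ι : Type*} [LinearOrder ι] [Fintype ι]
    (π : Equiv.Perm ι) (x y : Fock ι) :
    star ((fockRelabel π).val *ᵥ x) ⬝ᵥ ((fockRelabel π).val *ᵥ y) = star x ⬝ᵥ y := by
  rw [star_mulVec, dotProduct_mulVec, vecMul_vecMul, fockRelabel_val, fockRelabel_conjTranspose_mul_self,
    vecMul_one]

/-- The eigenvalue of a unit (more generally nonzero-norm) eigenvector of an inner-product preserving map has
`star mu * mu = 1`. [folklore] -/
theorem star_mul_self_eq_one_of_eigen {n : Type*} [Fintype n]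
    (V : Matrix n n ℂ) (mu : ℂ) (χ : n → ℂ)
    (hV : ∀ x y : n → ℂ, star (V *ᵥ x) ⬝ᵥ (V *ᵥ y) = star x ⬝ᵥ y)
    (hχ : V *ᵥ χ = mu • χ) (hχ1 : star χ ⬝ᵥ χ = 1) :
    star mu * mu = 1 := by
  have h := hV χ χ
  rw [hχ, star_smul, smul_dotProduct, dotProduct_smul, smul_eq_mul, smul_eq_mul, hχ1, mul_one] at h
  exact h

/-! ## The space group of the square torus twists `Δ_d` by the `B₁g` character -/

section Torus

variable {L : ℕ} [NeZero L]

/-- **`U_g Δ_d = χ_{B₁g}(γ) • Δ_d U_g`** for the space-group unitary `U_g = U_γ U_v` (`fockD4 γ * fockTranslate v`):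
the `d_{x²-y²}` pair field is translation invariant and transforms in the `B₁g` representation of `D₄`.
[cite: Scalapino1995, §2 eq. (2.3)] -/
theorem spaceGroup_mul_pairField_dWave (γ : DihedralGroup 4) (v : Literature.Probability.LatticeModels.TorusSite 2 L) :
    ((fockD4 (L := L) γ).val * (fockTranslate v).val) * pairField dWaveFormFactor L =
      b1gChar γ • (pairField dWaveFormFactor L * ((fockD4 (L := L) γ).val * (fockTranslate v).val)) := by
  -- translations: `U_v Δ_d = Δ_d U_v`
  have hT : (fockTranslate v).val * pairField dWaveFormFactor L =
      pairField dWaveFormFactor L * (fockTranslate v).val :=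
    (fockRelabel_commute_of_relabel_eq _ (relabel_translate_pairField dWaveFormFactor v)).eq
  -- point group: `U_γ Δ_d U_γᴴ = χ • Δ_d`, hence `U_γ Δ_d = (χ • Δ_d) U_γ`
  have hD : (fockD4 (L := L) γ).val * pairField dWaveFormFactor L =
      (b1gChar γ • pairField dWaveFormFactor L) * (fockD4 (L := L) γ).val := by
    refine fockRelabel_mul_eq_of_conj_eq _ ?_
    rw [← relabel_eq_fockRelabel_conj]
    exact relabel_d4Perm_pairField_dWave γ
  rw [Matrix.mul_assoc, hT, ← Matrix.mul_assoc, hD, smul_mul_assoc, smul_mul_assoc, Matrix.mul_assoc]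

/-- The space-group unitary `U_γ U_v` preserves the Hermitian inner product. [folklore] -/
theorem star_spaceGroup_mulVec_dotProduct (γ : DihedralGroup 4) (v : Literature.Probability.LatticeModels.TorusSite 2 L)
    (x y : Fock (Orb (FermionTorus 2 L))) :
    star (((fockD4 (L := L) γ).val * (fockTranslate v).val) *ᵥ x) ⬝ᵥ
        (((fockD4 (L := L) γ).val * (fockTranslate v).val) *ᵥ y) = star x ⬝ᵥ y := by
  rw [← mulVec_mulVec, ← mulVec_mulVec, fockD4_apply, star_fockRelabel_mulVec_dotProduct_mulVec,
    star_fockRelabel_mulVec_dotProduct_mulVec]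

end Torus

/-! ## Hypothesis H and the negative lemma -/

/-- HYPOTHESIS H — **floor symmetry mismatch** (the route's kill criterion (a)/(b) as a `Prop`; NOT constructible in the
tree today): for every `U > 0`, `δ ∈ (0, 1/2)` and threshold `L₀` there is an even side `L ≥ L₀`, a space-group element
`g = (γ, v)` of the square torus, a unit ground state `φ` of `hubbardTorus 2 L 1 U` in `(N_L, S^z = 0)`
(`N_L = 2⌊(1 − δ)L²/2⌋`) which is a `U_g`-eigenvector, `U_g φ = lam • φ`, such that the whole ground floor of
`(N_L − 2, S^z = 0)` is `U_g`-isotypic, `U_g χ = mu • χ`, with the WRONG character: `mu ≠ χ_{B₁g}(γ) · lam`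
(momentum mismatch for `γ = 1`; `C₄`-character mismatch for `v = 0`). -/
def FloorSymmetryMismatch : Prop :=
  ∀ U : ℝ, 0 < U → ∀ δ ∈ Set.Ioo (0 : ℝ) (1 / 2), ∀ L₀ : ℕ,
    ∃ (L : ℕ) (_ : NeZero L), Even L ∧ L₀ ≤ L ∧
      ∃ (γ : DihedralGroup 4) (v : Literature.Probability.LatticeModels.TorusSite 2 L) (lam mu : ℂ)
        (φ : Fock (Orb (FermionTorus 2 L))),
        IsGroundStateInSector (hubbardTorus 2 L 1 U) (2 * ⌊(1 - δ) * (L : ℝ) ^ 2 / 2⌋₊) 0 φ ∧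
        star φ ⬝ᵥ φ = 1 ∧
        ((fockD4 (L := L) γ).val * (fockTranslate v).val) *ᵥ φ = lam • φ ∧
        (∀ χ : Fock (Orb (FermionTorus 2 L)),
          IsGroundStateInSector (hubbardTorus 2 L 1 U) (2 * ⌊(1 - δ) * (L : ℝ) ^ 2 / 2⌋₊ - 2) 0 χ →
            ((fockD4 (L := L) γ).val * (fockTranslate v).val) *ᵥ χ = mu • χ) ∧
        mu ≠ b1gChar γ * lam

/-- **THE NEGATIVE LEMMA: a floor symmetry mismatch infinitely often in `L` at every `(U, δ)` refutes the every-ground-state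
pair bridge.** Given the crux's `(U, δ, a, L₀)`, H supplies an even `L ≥ L₀`, `g`, and a unit ground state `φ` of
`(N_L, 0)`; the crux supplies a unit ground state `χ` of `(N_L − 2, 0)` with `a L⁴ ≤ |⟨χ, Δ_d φ⟩|²`; but `U_g χ = mu χ`,
`U_g φ = lam φ`, `U_g Δ_d = χ_{B₁g}(γ) Δ_d U_g` and `mu ≠ χ_{B₁g}(γ) lam` (with `|mu| = 1` from `‖χ‖ = 1`) force
`⟨χ, Δ_d φ⟩ = 0`, contradicting `a L⁴ > 0`. [folklore] -/
theorem JmPairBridge_false_of_FloorSymmetryMismatch (hM : FloorSymmetryMismatch) : ¬ JmPairBridge := by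
  intro hX
  obtain ⟨U, hU, δ, hδ, a, ha, L₀, hbridge⟩ := hX
  obtain ⟨L, hLnz, hLeven, hL₀, γ, v, lam, mu, φ, hφ, hφ1, hVφ, hVfloor, hne⟩ := hM U hU δ hδ L₀
  obtain ⟨χ, hχ, hχ1, hle⟩ := hbridge L hLeven hL₀ φ hφ hφ1
  set V : Matrix (Finset (Orb (FermionTorus 2 L))) (Finset (Orb (FermionTorus 2 L))) ℂ :=
    (fockD4 (L := L) γ).val * (fockTranslate v).val with hVdef
  have hV : ∀ x y, star (V *ᵥ x) ⬝ᵥ (V *ᵥ y) = star x ⬝ᵥ y := star_spaceGroup_mulVec_dotProduct γ v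
  have hVχ : V *ᵥ χ = mu • χ := hVfloor χ hχ
  -- `|mu| = 1`, so `mu ≠ χ lam` is `star mu * χ * lam ≠ 1`
  have hmu : star mu * mu = 1 := star_mul_self_eq_one_of_eigen V mu χ hV hVχ hχ1
  have hne' : star mu * b1gChar γ * lam ≠ 1 := by
    intro h1
    apply hne
    calc mu = mu * (star mu * b1gChar γ * lam) := by rw [h1, mul_one]
      _ = (star mu * mu) * (b1gChar γ * lam) := by ring
      _ = b1gChar γ * lam := by rw [hmu, one_mul]
  have hz : star χ ⬝ᵥ (pairField dWaveFormFactor L *ᵥ φ) = 0 :=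
    dotProduct_mulVec_eq_zero_of_twisted_eigen V (pairField dWaveFormFactor L) (b1gChar γ) lam mu φ χ hV
      (spaceGroup_mul_pairField_dWave γ v) hVφ hVχ hne'
  have hle' : a * (L : ℝ) ^ 4 ≤ 0 := by
    have := hle
    rw [hz, norm_zero] at this
    simpa using this
  have hLpos : (0 : ℝ) < (L : ℝ) := by exact_mod_cast Nat.pos_of_ne_zero (NeZero.ne L)
  have : 0 < a * (L : ℝ) ^ 4 := by positivity
  linarith

end Summit.HubbardSuperconductivity.JmPairBridgeNegative

end
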